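import Literature.NumberTheory.DiophantineGeometry.CatalanThaineNorm
import Literature.NumberTheory.DiophantineGeometry.CatalanMinusPower
import HarnessLib

/-!
# Thaine's theorem for `ℚ(ζ_p)`, IV: the annihilator of the auxiliary prime [Schoof2009, Thm 16.3]

The end of the proof of [Schoof2009, Theorem 16.3] (p. 110): the congruences
`γ ≡ s^{-r_σ} (mod σ(𝔩))` (part II) say that the "index vector" of the cyclotomic unit `γ` modulo
the primes `σ(𝔩)` over the auxiliary prime `l` is `-r = -(r_σ)_σ`, and the norm computation
`(N α) = 𝔟^{l-1} ∏_σ σ(𝔩)^{r_σ}` (part III) says that `∑_σ r_σ σ` kills the class of `𝔩` modulo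
`q`-th powers (`q ∣ l - 1`); the set of such annihilating vectors is an ideal of `𝔽_q[G]`, and the
hypotheses of Thaine's theorem (`θ` kills `u` modulo cyclotomic units and `q`-th powers, `u` a
generator whose index vector is invertible) then put `θ` in that ideal.

This file provides the bookkeeping, free of discrete logarithms and of the class group:

* `Catalan.Thaine.conv` — the convolution `(f ⋆ g)(b) = ∑_a f(a) g(a⁻¹ b)` on functions
  `(ℤ/p)ˣ → R` (the group ring `R[G]`, `G = Gal(K/ℚ) ≅ (ℤ/p)ˣ` via `σ_a`);
* `Catalan.Thaine.Rep 𝔩 s q x k` — *"`x ≡ s^{k_b} · (q-th power) (mod σ_b(𝔩))` for all `b`"*, the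
  discrete-log-free form of "the index vector of `x` is `k` modulo `q`", with its calculus
  (`Rep.mul`, `Rep.smul_gal`, `Rep.galPow`, `Rep.of_mul_pow`, uniqueness `Rep.modEq`);
* `Catalan.Thaine.Ann 𝔩 q k` — *"`∏_b σ_b(𝔩)^{k_b}` is principal times a `q`-th power"*, an additive
  subgroup of `(ℤ/q)^G` stable under translations, hence under convolution (`Ann.conv`);
* `Catalan.Thaine.Ann.of_galPow` — the endgame: if `u^θ` has index vector `k ∈ Ann` and `u^y` has
  index vector `½(δ_1 + δ_ι)`, then `θ ∈ Ann` (`(u^θ)^y = (u^y)^θ`, uniqueness of index vectors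
  modulo `q`, `θ ⋆ e⁺ = θ` for symmetric `θ`);
* the glue with parts I–III: `primeOver` (the prime `𝔏_b` of `L` over `σ_b(𝔩)`), `rep_cycElt`
  (part II: `γ` has index vector `(l-2)·r`, `r_b = v_{𝔏_b}(α)`), `smul_injective` (`l ≡ 1 (mod p)`
  splits completely), `prod_filter_map_relNorm_eq`, `ann_val` (part III: `r ∈ Ann`);
* `Catalan.Thaine.ann_of_galPow_mul_pow_eq`, `thaine_aux` — **[Schoof2009, Theorem 16.3] for a
  given auxiliary prime**: if `u₀^θ w^q = γ v^q` (`θ` symmetric, `γ` a cyclotomic unit, `v, w` prime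
  to `l`) and the auxiliary prime `𝔩 ∣ l ≡ 1 (mod pq)` is such that some `u₀^y` has index vector
  `½(δ_1 + δ_ι)` ([Schoof2009, Lemma 16.2]), then `∏_b σ_b(𝔩)^{t_b}` is principal times a `q`-th
  power (`thaine_aux` discharges the primitive-root hypotheses via `𝓞 K/σ_b(𝔩) ≅ ℤ/l`,
  `card_quot_smul`, `dvd_of_pow_sub_pow_mem`).

Everything is proved; the definitions are `conv`, `translate`, `galPow` (`x^θ = ∏_a σ_a(x)^{t_a}`),
`Rep`, `Ann`, `primeOver`.

## References

* R. Schoof, *Catalan's Conjecture*, Universitext, Springer 2009 [Schoof2009], proof of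
  Theorem 16.3 (book p. 110) — held, `lit read book:schoof2009-catalan-s-conjecture` (PDF p. 185).
* L. C. Washington, *Introduction to Cyclotomic Fields*, GTM 83, Springer 1997 [Washington1997],
  §15.2 (Thaine's theorem).
-/

namespace Literature.NumberTheory.DiophantineGeometry

namespace Catalan.Thaine

open NumberField Finset Ideal
open Literature.NumberTheory.NumberFields.Stickelberger
open scoped Pointwise

/-! ### Convolution on `(ℤ/p)ˣ → R` -/

section Conv

variable {p : ℕ} [Fact p.Prime] {R : Type*} [CommSemiring R]

/-- **the convolution `(f ⋆ g)(b) = ∑_a f(a) g(a⁻¹ b)`** (the product of the group ring `R[(ℤ/p)ˣ]`).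
[folklore] -/
def conv (f g : (ZMod p)ˣ → R) : (ZMod p)ˣ → R := fun b => ∑ a, f a * g (a⁻¹ * b)

/-- the translate `b ↦ g(a⁻¹ b)`. [folklore] -/
def translate (a : (ZMod p)ˣ) (g : (ZMod p)ˣ → R) : (ZMod p)ˣ → R := fun b => g (a⁻¹ * b)

/-- `f ⋆ g = ∑_a f(a) · (translate of g by a)`. [folklore] -/
theorem conv_eq_sum_translate (f g : (ZMod p)ˣ → R) :
    conv f g = ∑ a, f a • translate a g := by
  funext b
  simp [conv, translate, Finset.sum_apply, smul_eq_mul]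

/-- convolution is commutative. [folklore] -/
theorem conv_comm (f g : (ZMod p)ˣ → R) : conv f g = conv g f := by
  funext b
  unfold conv
  -- reindex `a ↦ b a⁻¹`
  rw [← Equiv.sum_comp ((Equiv.inv (ZMod p)ˣ).trans (Equiv.mulLeft b)) (fun a => g a * f (a⁻¹ * b))]
  refine Finset.sum_congr rfl fun a _ => ?_
  simp only [Equiv.trans_apply, Equiv.inv_apply, Equiv.coe_mulLeft, mul_inv_rev, inv_inv]
  rw [mul_comm (f a), inv_mul_cancel_right, mul_comm b]

/-- convolution is additive on the right. [folklore] -/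
theorem conv_add (f g h : (ZMod p)ˣ → R) : conv f (g + h) = conv f g + conv f h := by
  funext b
  simp [conv, mul_add, Finset.sum_add_distrib]

/-- the point masses: `conv δ_a g = translate a g`. [folklore] -/
theorem conv_single [DecidableEq (ZMod p)ˣ] (a : (ZMod p)ˣ) (g : (ZMod p)ˣ → R) :
    conv (Pi.single a 1) g = translate a g := by
  funext b
  simp [conv, translate, Pi.single_apply, Finset.sum_ite_eq']

end Conv

/-! ### `Rep`: index vectors without discrete logarithms -/

section Rep

variable {p : ℕ} [hp : Fact p.Prime] {K : Type*} [Field K] [NumberField K]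
  [hK : IsCyclotomicExtension {p} ℚ K]
variable (𝔩 : Ideal (𝓞 K)) (s q : ℕ)

/-- **`Rep 𝔩 s q x k`: `x ≡ s^{k_b} · z_b^q (mod σ_b(𝔩))` with `z_b ∉ σ_b(𝔩)`, for every `b`** — i.e.
"the index of `x` modulo `σ_b(𝔩)` with respect to the primitive root `s` is `k_b` modulo `q`"
(the map `E → (O/l O)^*/q` of [Schoof2009, p. 110]), stated without discrete logarithms.
[cite: Schoof2009, Theorem 16.3 (proof, pp. 109–110)] -/
def Rep (x : 𝓞 K) (k : (ZMod p)ˣ → ℕ) : Prop :=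
  ∀ b : (ZMod p)ˣ, ∃ z : 𝓞 K, z ∉ gal p K b • 𝔩 ∧ x - (s : 𝓞 K) ^ k b * z ^ q ∈ gal p K b • 𝔩

/-- **`x^θ = ∏_a σ_a(x)^{t_a}`**, the action of `θ = ∑_a t_a σ_a ∈ ℕ[G]` on `𝓞 K ∖ 0`.
[cite: Schoof2009, §16 (p. 108)] -/
noncomputable def galPow (t : (ZMod p)ˣ → ℕ) (x : 𝓞 K) : 𝓞 K := ∏ a, (gal p K a • x) ^ t a

variable {𝔩 s q}

/-- `σ_b(𝔩)` is prime. [folklore] -/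
theorem isPrime_smul [𝔩.IsPrime] (b : (ZMod p)ˣ) : (gal p K b • 𝔩).IsPrime := inferInstance

/-- `Rep 1 0`. [folklore] -/
theorem Rep.one [𝔩.IsPrime] : Rep 𝔩 s q 1 (0 : (ZMod p)ˣ → ℕ) := fun b =>
  ⟨1, fun h => (isPrime_smul b).ne_top ((Ideal.eq_top_iff_one _).mpr h), by simp⟩

/-- **`Rep` is multiplicative.** [folklore] -/
theorem Rep.mul [𝔩.IsPrime] {x x' : 𝓞 K} {k k' : (ZMod p)ˣ → ℕ} (h : Rep 𝔩 s q x k)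
    (h' : Rep 𝔩 s q x' k') : Rep 𝔩 s q (x * x') (k + k') := by
  intro b
  obtain ⟨z, hz, hx⟩ := h b
  obtain ⟨z', hz', hx'⟩ := h' b
  refine ⟨z * z', fun hzz => ?_, ?_⟩
  · rcases (isPrime_smul b).mem_or_mem hzz with h1 | h1
    · exact hz h1
    · exact hz' h1
  · have e : x * x' - (s : 𝓞 K) ^ (k + k') b * (z * z') ^ q =
        x * (x' - (s : 𝓞 K) ^ k' b * z' ^ q) + (s : 𝓞 K) ^ k' b * z' ^ q * (x - (s : 𝓞 K) ^ k b * z ^ q) := by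
      simp only [Pi.add_apply, pow_add, mul_pow]; ring
    rw [e]
    exact Ideal.add_mem _ (Ideal.mul_mem_left _ _ hx') (Ideal.mul_mem_left _ _ hx)

/-- `Rep` of powers. [folklore] -/
theorem Rep.pow [𝔩.IsPrime] {x : 𝓞 K} {k : (ZMod p)ˣ → ℕ} (h : Rep 𝔩 s q x k) (n : ℕ) :
    Rep 𝔩 s q (x ^ n) (n • k) := by
  induction n with
  | zero => rw [pow_zero, zero_smul]; exact Rep.one
  | succ n ih => rw [pow_succ, succ_nsmul]; exact ih.mul h

/-- `Rep` of products. [folklore] -/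
theorem Rep.prod [𝔩.IsPrime] {ι : Type*} (S : Finset ι) {f : ι → 𝓞 K} {k : ι → (ZMod p)ˣ → ℕ}
    (h : ∀ i ∈ S, Rep 𝔩 s q (f i) (k i)) : Rep 𝔩 s q (∏ i ∈ S, f i) (∑ i ∈ S, k i) := by
  classical
  induction S using Finset.induction_on with
  | empty => rw [Finset.prod_empty, Finset.sum_empty]; exact Rep.one
  | insert j S hj ih =>
    rw [Finset.prod_insert hj, Finset.sum_insert hj]
    exact (h j (Finset.mem_insert_self _ _)).mul (ih fun i hi => h i (Finset.mem_insert_of_mem hi))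

/-- **`Rep` is `G`-equivariant**: `σ_a(x)` has the translated index vector `b ↦ k(a⁻¹ b)`.
[cite: Schoof2009, §16 (p. 110: "`G`-homomorphism")] -/
theorem Rep.smul_gal {x : 𝓞 K} {k : (ZMod p)ˣ → ℕ} (h : Rep 𝔩 s q x k) (a : (ZMod p)ˣ) :
    Rep 𝔩 s q (gal p K a • x) (translate a k) := by
  intro b
  obtain ⟨z, hz, hx⟩ := h (a⁻¹ * b)
  refine ⟨gal p K a • z, fun hmem => hz ?_, ?_⟩
  · have := (Ideal.smul_mem_pointwise_smul_iff (a := (gal p K a)⁻¹)).mpr hmem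
    rwa [inv_smul_smul, smul_smul, ← gal_inv, ← gal_mul] at this
  · have := (Ideal.smul_mem_pointwise_smul_iff (a := gal p K a)).mpr hx
    rw [smul_smul, ← gal_mul, ← mul_assoc, mul_inv_cancel, one_mul, smul_sub, smul_mul', smul_pow',
      smul_pow'] at this
    have hs : gal p K a • ((s : ℕ) : 𝓞 K) = (s : 𝓞 K) := by
      have := map_natCast (MulSemiringAction.toRingHom Gal(K/ℚ) (𝓞 K) (gal p K a)) s
      rwa [MulSemiringAction.toRingHom_apply] at this
    rwa [hs] at this

/-- **`Rep (x^θ) (θ ⋆ k)`**: the index vector of `x^θ = ∏_a σ_a(x)^{t_a}` is the convolution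
`θ ⋆ k`. [cite: Schoof2009, §16 (p. 110)] -/
theorem Rep.galPow [𝔩.IsPrime] {x : 𝓞 K} {k : (ZMod p)ˣ → ℕ} (h : Rep 𝔩 s q x k)
    (t : (ZMod p)ˣ → ℕ) : Rep 𝔩 s q (galPow t x) (conv t k) := by
  rw [conv_eq_sum_translate]
  exact Rep.prod _ fun a _ => (h.smul_gal a).pow (t a)

/-- `q`-th powers of elements prime to `l` have index `0`. [folklore] -/
theorem Rep.pow_q {w : 𝓞 K} (hw : ∀ b, w ∉ gal p K b • 𝔩) :
    Rep 𝔩 s q (w ^ q) (0 : (ZMod p)ˣ → ℕ) := fun b =>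
  ⟨w, hw b, by simp⟩

/-- **division by a `q`-th power**: `Rep (x w^q) k → Rep x k` for `w` prime to `l`. [folklore] -/
theorem Rep.of_mul_pow (h𝔩 : ∀ b, (gal p K b • 𝔩).IsMaximal) {x w : 𝓞 K} {k : (ZMod p)ˣ → ℕ}
    (h : Rep 𝔩 s q (x * w ^ q) k) (hw : ∀ b, w ∉ gal p K b • 𝔩) : Rep 𝔩 s q x k := by
  intro b
  obtain ⟨z, hz, hx⟩ := h b
  obtain ⟨y, i, hi, hyi⟩ := (h𝔩 b).exists_inv (hw b)
  have hP := (h𝔩 b).isPrime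
  refine ⟨z * y, fun hzy => ?_, ?_⟩
  · rcases hP.mem_or_mem hzy with h1 | h1
    · exact hz h1
    · apply hP.ne_top
      rw [Ideal.eq_top_iff_one, ← hyi]
      exact Ideal.add_mem _ (Ideal.mul_mem_right _ _ h1) hi
  · have hwy : 1 - w * y ∈ gal p K b • 𝔩 := by
      have : 1 - w * y = i := by rw [← hyi]; ring
      rw [this]; exact hi
    obtain ⟨c, hc⟩ := sub_dvd_pow_sub_pow (1 : 𝓞 K) (w * y) q
    have e : x - (s : 𝓞 K) ^ k b * (z * y) ^ q =
        x * (1 ^ q - (w * y) ^ q) + y ^ q * (x * w ^ q - (s : 𝓞 K) ^ k b * z ^ q) := by ring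
    rw [e, hc]
    exact Ideal.add_mem _ (Ideal.mul_mem_left _ _ (Ideal.mul_mem_right _ _ hwy))
      (Ideal.mul_mem_left _ _ hx)

/-- the key divisibility behind uniqueness: if `s^k z^q ≡ s^{k'} z'^q` with `k ≤ k'` then
`q ∣ k' - k`, given that `s^d` is a `q`-th power residue only for `q ∣ d`. [folklore] -/
theorem Rep.dvd_sub_aux (h𝔩 : ∀ b, (gal p K b • 𝔩).IsMaximal) (hs : ∀ b, (s : 𝓞 K) ∉ gal p K b • 𝔩)
    (hsq : ∀ (b : (ZMod p)ˣ) (d : ℕ),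
      (∃ z : 𝓞 K, z ∉ gal p K b • 𝔩 ∧ (s : 𝓞 K) ^ d - z ^ q ∈ gal p K b • 𝔩) → q ∣ d)
    (b : (ZMod p)ˣ) {k k' : ℕ} (hkk' : k ≤ k') {z z' : 𝓞 K} (hz : z ∉ gal p K b • 𝔩)
    (hz' : z' ∉ gal p K b • 𝔩)
    (h : (s : 𝓞 K) ^ k * z ^ q - (s : 𝓞 K) ^ k' * z' ^ q ∈ gal p K b • 𝔩) : q ∣ k' - k := by
  have hP := (h𝔩 b).isPrime
  obtain ⟨d, rfl⟩ := Nat.exists_eq_add_of_le hkk'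
  rw [Nat.add_sub_cancel_left]
  -- `s^k (z^q - s^d z'^q) ∈ 𝔩_b`, so `z^q ≡ s^d z'^q`
  have h1 : z ^ q - (s : 𝓞 K) ^ d * z' ^ q ∈ gal p K b • 𝔩 := by
    have e : (s : 𝓞 K) ^ k * z ^ q - (s : 𝓞 K) ^ (k + d) * z' ^ q =
        (s : 𝓞 K) ^ k * (z ^ q - (s : 𝓞 K) ^ d * z' ^ q) := by ring
    rw [e] at h
    rcases hP.mem_or_mem h with h2 | h2
    · exact absurd (hP.mem_of_pow_mem _ h2) (hs b)
    · exact h2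
  -- invert `z'`
  obtain ⟨y, i, hi, hyi⟩ := (h𝔩 b).exists_inv hz'
  refine hsq b d ⟨z * y, fun hzy => ?_, ?_⟩
  · rcases hP.mem_or_mem hzy with h3 | h3
    · exact hz h3
    · apply hP.ne_top
      rw [Ideal.eq_top_iff_one, ← hyi]
      exact Ideal.add_mem _ (Ideal.mul_mem_right _ _ h3) hi
  · have hwy : 1 - z' * y ∈ gal p K b • 𝔩 := by
      have : 1 - z' * y = i := by rw [← hyi]; ring
      rw [this]; exact hi
    obtain ⟨c, hc⟩ := sub_dvd_pow_sub_pow (1 : 𝓞 K) (z' * y) q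
    have e : (s : 𝓞 K) ^ d - (z * y) ^ q =
        (s : 𝓞 K) ^ d * (1 ^ q - (z' * y) ^ q) - y ^ q * (z ^ q - (s : 𝓞 K) ^ d * z' ^ q) := by ring
    rw [e, hc]
    exact Ideal.sub_mem _ (Ideal.mul_mem_left _ _ (Ideal.mul_mem_right _ _ hwy))
      (Ideal.mul_mem_left _ _ h1)

/-- **uniqueness of the index vector modulo `q`.** [cite: Schoof2009, §16 (p. 110)] -/
theorem Rep.natCast_eq (h𝔩 : ∀ b, (gal p K b • 𝔩).IsMaximal) (hs : ∀ b, (s : 𝓞 K) ∉ gal p K b • 𝔩)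
    (hsq : ∀ (b : (ZMod p)ˣ) (d : ℕ),
      (∃ z : 𝓞 K, z ∉ gal p K b • 𝔩 ∧ (s : 𝓞 K) ^ d - z ^ q ∈ gal p K b • 𝔩) → q ∣ d)
    {x : 𝓞 K} {k k' : (ZMod p)ˣ → ℕ} (h : Rep 𝔩 s q x k) (h' : Rep 𝔩 s q x k') (b : (ZMod p)ˣ) :
    ((k b : ℕ) : ZMod q) = ((k' b : ℕ) : ZMod q) := by
  obtain ⟨z, hz, hx⟩ := h b
  obtain ⟨z', hz', hx'⟩ := h' b
  have hdiff : (s : 𝓞 K) ^ k b * z ^ q - (s : 𝓞 K) ^ k' b * z' ^ q ∈ gal p K b • 𝔩 := by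
    have := Ideal.sub_mem _ hx' hx
    have e : x - (s : 𝓞 K) ^ k' b * z' ^ q - (x - (s : 𝓞 K) ^ k b * z ^ q) =
        (s : 𝓞 K) ^ k b * z ^ q - (s : 𝓞 K) ^ k' b * z' ^ q := by ring
    rwa [e] at this
  rcases le_total (k b) (k' b) with hle | hle
  · have hd := Rep.dvd_sub_aux h𝔩 hs hsq b hle hz hz' hdiff
    exact (ZMod.natCast_eq_natCast_iff _ _ _).mpr ((Nat.modEq_iff_dvd' hle).mpr hd)
  · have hdiff' : (s : 𝓞 K) ^ k' b * z' ^ q - (s : 𝓞 K) ^ k b * z ^ q ∈ gal p K b • 𝔩 := by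
      rw [← neg_sub]; exact (gal p K b • 𝔩).neg_mem hdiff
    have hd := Rep.dvd_sub_aux h𝔩 hs hsq b hle hz' hz hdiff'
    exact ((ZMod.natCast_eq_natCast_iff _ _ _).mpr ((Nat.modEq_iff_dvd' hle).mpr hd)).symm

end Rep

/-! ### `Ann`: the annihilating exponent vectors form an ideal -/

section Ann

variable {p : ℕ} [hp : Fact p.Prime] {K : Type*} [Field K] [NumberField K]
  [hK : IsCyclotomicExtension {p} ℚ K]
variable (𝔩 : Ideal (𝓞 K)) (q : ℕ) [NeZero q]

/-- **`Ann 𝔩 q k`: the ideal `∏_b σ_b(𝔩)^{k_b}` is principal modulo `q`-th powers of ideals**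
(i.e. the element `∑_b k_b σ_b ∈ 𝔽_q[G]` kills the class of `𝔩` in `Cl_K/Cl_K^q`), stated without
the class group. [cite: Schoof2009, Theorem 16.3 ("`θ` annihilates `Cl⁺/Cl⁺^q`")] -/
def Ann (k : (ZMod p)ˣ → ZMod q) : Prop :=
  ∃ (β₁ β₂ : 𝓞 K) (J₁ J₂ : Ideal (𝓞 K)), β₁ ≠ 0 ∧ β₂ ≠ 0 ∧ J₁ ≠ ⊥ ∧ J₂ ≠ ⊥ ∧
    Ideal.span {β₁} * J₁ ^ q * ∏ b, (gal p K b • 𝔩) ^ (k b).val = Ideal.span {β₂} * J₂ ^ q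

variable {𝔩 q}

omit [NeZero q] in
/-- `σ_a(J) ≠ 0` for `J ≠ 0`. [folklore] -/
theorem gal_smul_ne_bot (a : (ZMod p)ˣ) {J : Ideal (𝓞 K)} (hJ : J ≠ ⊥) : gal p K a • J ≠ ⊥ :=
  fun h => hJ (by have := congrArg (fun I : Ideal (𝓞 K) => (gal p K a)⁻¹ • I) h; simpa using this)

omit [NeZero q] in
/-- `∏_b σ_b(𝔩)^{m_b} ≠ 0` for `𝔩 ≠ 0`. [folklore] -/
theorem prod_gal_smul_pow_ne_bot (h𝔩 : 𝔩 ≠ ⊥) (m : (ZMod p)ˣ → ℕ) :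
    ∏ b, (gal p K b • 𝔩) ^ m b ≠ ⊥ := by
  rw [Ne, ← Submodule.zero_eq_bot]
  exact Finset.prod_ne_zero_iff.mpr fun b _ => pow_ne_zero _ (by
    rw [Submodule.zero_eq_bot]; exact gal_smul_ne_bot b h𝔩)

omit [NeZero q] [NumberField K] in
/-- products of non-zero ideals are non-zero. [folklore] -/
theorem mul_ne_bot' {I J : Ideal (𝓞 K)} (hI : I ≠ ⊥) (hJ : J ≠ ⊥) : I * J ≠ ⊥ := by
  rw [Ne, Ideal.mul_eq_bot, not_or]; exact ⟨hI, hJ⟩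

omit [NeZero q] [NumberField K] in
/-- powers of non-zero ideals are non-zero. [folklore] -/
theorem pow_ne_bot' {I : Ideal (𝓞 K)} (hI : I ≠ ⊥) (n : ℕ) : I ^ n ≠ ⊥ := by
  rw [Ne, ← Submodule.zero_eq_bot] at hI ⊢
  exact pow_ne_zero n hI

omit [NeZero q] in
/-- **normalisation**: an ideal equation with natural exponents `n_b` gives `Ann (n mod q)`.
[folklore] -/
theorem Ann.of_nat (h𝔩 : 𝔩 ≠ ⊥) {n : (ZMod p)ˣ → ℕ} {β₁ β₂ : 𝓞 K} {J₁ J₂ : Ideal (𝓞 K)}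
    (h₁ : β₁ ≠ 0) (h₂ : β₂ ≠ 0) (hJ₁ : J₁ ≠ ⊥) (hJ₂ : J₂ ≠ ⊥)
    (h : Ideal.span {β₁} * J₁ ^ q * ∏ b, (gal p K b • 𝔩) ^ n b = Ideal.span {β₂} * J₂ ^ q) :
    Ann 𝔩 q (fun b => (n b : ZMod q)) := by
  refine ⟨β₁, β₂, J₁ * ∏ b, (gal p K b • 𝔩) ^ (n b / q), J₂, h₁, h₂,
    mul_ne_bot' hJ₁ (prod_gal_smul_pow_ne_bot h𝔩 _), hJ₂, ?_⟩
  have hprod : ∏ b, (gal p K b • 𝔩) ^ n b =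
      (∏ b, (gal p K b • 𝔩) ^ (n b / q)) ^ q * ∏ b, (gal p K b • 𝔩) ^ ((n b : ZMod q)).val := by
    rw [← Finset.prod_pow, ← Finset.prod_mul_distrib]
    refine Finset.prod_congr rfl fun b _ => ?_
    rw [← pow_mul, ← pow_add, ZMod.val_natCast, Nat.div_add_mod']
  rw [← h, hprod]
  ring

omit [NeZero q] in
/-- `Ann 0`. [folklore] -/
theorem Ann.zero : Ann 𝔩 q (0 : (ZMod p)ˣ → ZMod q) := by
  refine ⟨1, 1, 1, 1, one_ne_zero, one_ne_zero, ?_, ?_, ?_⟩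
  · rw [Ideal.one_eq_top]; exact top_ne_bot
  · rw [Ideal.one_eq_top]; exact top_ne_bot
  · simp only [Pi.zero_apply, ZMod.val_zero, pow_zero, Finset.prod_const_one, mul_one]

/-- **`Ann` is closed under addition.** [folklore] -/
theorem Ann.add (h𝔩 : 𝔩 ≠ ⊥) {k k' : (ZMod p)ˣ → ZMod q} (h : Ann 𝔩 q k) (h' : Ann 𝔩 q k') :
    Ann 𝔩 q (k + k') := by
  obtain ⟨β₁, β₂, J₁, J₂, h₁, h₂, hJ₁, hJ₂, h⟩ := h
  obtain ⟨β₁', β₂', J₁', J₂', h₁', h₂', hJ₁', hJ₂', h'⟩ := h'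
  have key := Ann.of_nat (𝔩 := 𝔩) (q := q) h𝔩 (n := fun b => (k b).val + (k' b).val) (β₁ := β₁ * β₁')
    (β₂ := β₂ * β₂') (J₁ := J₁ * J₁') (J₂ := J₂ * J₂') (mul_ne_zero h₁ h₁') (mul_ne_zero h₂ h₂')
    (mul_ne_bot' hJ₁ hJ₁') (mul_ne_bot' hJ₂ hJ₂') (by
      have e := congrArg₂ (· * ·) h h'
      rw [← Ideal.span_singleton_mul_span_singleton, ← Ideal.span_singleton_mul_span_singleton]
      simp only [pow_add, Finset.prod_mul_distrib, mul_pow]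
      calc _ = (Ideal.span {β₁} * J₁ ^ q * ∏ b, (gal p K b • 𝔩) ^ (k b).val) *
            (Ideal.span {β₁'} * J₁' ^ q * ∏ b, (gal p K b • 𝔩) ^ (k' b).val) := by ring
        _ = _ := e
        _ = _ := by ring)
  convert key using 1
  funext b
  simp [ZMod.natCast_val, ZMod.cast_id]

omit [NeZero q] in
/-- **`Ann` is stable under translations** (apply `σ_a` to the ideal equation). [folklore] -/
theorem Ann.translate {k : (ZMod p)ˣ → ZMod q} (h : Ann 𝔩 q k) (a : (ZMod p)ˣ) :
    Ann 𝔩 q (translate a k) := by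
  obtain ⟨β₁, β₂, J₁, J₂, h₁, h₂, hJ₁, hJ₂, h⟩ := h
  have hne : ∀ {β : 𝓞 K}, β ≠ 0 → gal p K a • β ≠ 0 := fun {β} hβ h0 =>
    hβ (by have := congrArg (fun x => (gal p K a)⁻¹ • x) h0; simpa using this)
  refine ⟨gal p K a • β₁, gal p K a • β₂, gal p K a • J₁, gal p K a • J₂, hne h₁, hne h₂,
    gal_smul_ne_bot a hJ₁, gal_smul_ne_bot a hJ₂, ?_⟩
  have e := congrArg (fun I : Ideal (𝓞 K) => gal p K a • I) h
  simp only [smul_mul', smul_pow', Finset.smul_prod'] at e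
  have hspan : ∀ β : 𝓞 K, gal p K a • (Ideal.span {β} : Ideal (𝓞 K)) = Ideal.span {gal p K a • β} := by
    intro β
    rw [Ideal.pointwise_smul_def, Ideal.map_span, Set.image_singleton]
    rfl
  rw [hspan, hspan] at e
  convert e using 2
  -- reindex `b ↦ a b`
  symm
  exact Fintype.prod_equiv (Equiv.mulLeft a) _ _ fun x => by
    simp only [Equiv.coe_mulLeft, Thaine.translate, inv_mul_cancel_left, smul_smul, ← gal_mul]

/-- `Ann` is closed under natural multiples. [folklore] -/
theorem Ann.nsmul (h𝔩 : 𝔩 ≠ ⊥) {k : (ZMod p)ˣ → ZMod q} (h : Ann 𝔩 q k) (n : ℕ) :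
    Ann 𝔩 q (n • k) := by
  induction n with
  | zero => rw [zero_smul]; exact Ann.zero
  | succ n ih => rw [succ_nsmul]; exact ih.add h𝔩 h

/-- `Ann` is closed under sums. [folklore] -/
theorem Ann.sum (h𝔩 : 𝔩 ≠ ⊥) {ι : Type*} (S : Finset ι) {k : ι → (ZMod p)ˣ → ZMod q}
    (h : ∀ i ∈ S, Ann 𝔩 q (k i)) : Ann 𝔩 q (∑ i ∈ S, k i) := by
  classical
  induction S using Finset.induction_on with
  | empty => rw [Finset.sum_empty]; exact Ann.zero
  | insert j S hj ih =>
    rw [Finset.sum_insert hj]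
    exact (h j (Finset.mem_insert_self _ _)).add h𝔩
      (ih fun i hi => h i (Finset.mem_insert_of_mem hi))

/-- **`Ann` is an ideal of `𝔽_q[G]`**: closed under convolution by anything. [cite: Schoof2009,
Theorem 16.3 (proof, p. 110)] -/
theorem Ann.conv (h𝔩 : 𝔩 ≠ ⊥) (f : (ZMod p)ˣ → ZMod q) {k : (ZMod p)ˣ → ZMod q} (h : Ann 𝔩 q k) :
    Ann 𝔩 q (conv f k) := by
  rw [conv_eq_sum_translate]
  refine Ann.sum h𝔩 _ fun a _ => ?_
  have : f a • Thaine.translate a k = (f a).val • Thaine.translate a k := by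
    conv_lhs => rw [← ZMod.natCast_zmod_val (f a)]
    exact Nat.cast_smul_eq_nsmul _ _ _
  rw [this]
  exact (h.translate a).nsmul h𝔩 _

omit [NeZero q] in
/-- the converse normalisation: `Ann (t mod q)` gives an ideal equation with the exponents `t_b`.
[folklore] -/
theorem Ann.to_nat [NeZero q] (h𝔩 : 𝔩 ≠ ⊥) {t : (ZMod p)ˣ → ℕ}
    (h : Ann 𝔩 q (fun b => (t b : ZMod q))) :
    ∃ (β₁ β₂ : 𝓞 K) (J₁ J₂ : Ideal (𝓞 K)), β₁ ≠ 0 ∧ β₂ ≠ 0 ∧ J₁ ≠ ⊥ ∧ J₂ ≠ ⊥ ∧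
      Ideal.span {β₁} * J₁ ^ q * ∏ b, (gal p K b • 𝔩) ^ t b = Ideal.span {β₂} * J₂ ^ q := by
  obtain ⟨β₁, β₂, J₁, J₂, h₁, h₂, hJ₁, hJ₂, h⟩ := h
  refine ⟨β₁, β₂, J₁, J₂ * ∏ b, (gal p K b • 𝔩) ^ (t b / q), h₁, h₂, hJ₁,
    mul_ne_bot' hJ₂ (prod_gal_smul_pow_ne_bot h𝔩 _), ?_⟩
  have hprod : ∏ b, (gal p K b • 𝔩) ^ t b =
      (∏ b, (gal p K b • 𝔩) ^ ((t b : ZMod q)).val) * (∏ b, (gal p K b • 𝔩) ^ (t b / q)) ^ q := by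
    rw [← Finset.prod_pow, ← Finset.prod_mul_distrib]
    refine Finset.prod_congr rfl fun b _ => ?_
    rw [← pow_mul, ← pow_add, ZMod.val_natCast, Nat.mod_add_div']
  rw [hprod, ← mul_assoc, h]
  ring

end Ann

/-! ### The endgame -/

section Endgame

variable {p : ℕ} [hp : Fact p.Prime] {K : Type*} [Field K] [NumberField K]
  [hK : IsCyclotomicExtension {p} ℚ K]

/-- **`(x^θ)^y = (x^y)^θ`** in the commutative group ring: `galPow y (galPow t x) = galPow t (galPow y x)`.
[folklore] -/
theorem galPow_comm (t y : (ZMod p)ˣ → ℕ) (x : 𝓞 K) :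
    galPow y (galPow t x) = galPow t (galPow y x) := by
  unfold galPow
  have key : ∀ (f g : (ZMod p)ˣ → ℕ), ∏ a, (gal p K a • ∏ b, (gal p K b • x) ^ f b) ^ g a =
      ∏ a, ∏ b, (gal p K (a * b) • x) ^ (f b * g a) := by
    intro f g
    refine Finset.prod_congr rfl fun a _ => ?_
    rw [Finset.smul_prod', ← Finset.prod_pow]
    refine Finset.prod_congr rfl fun b _ => ?_
    rw [smul_pow', smul_smul, ← gal_mul, ← pow_mul]
  rw [key, key, Finset.prod_comm]
  refine Finset.prod_congr rfl fun a _ => Finset.prod_congr rfl fun b _ => ?_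
  rw [mul_comm b a, mul_comm (t a)]

/-- casting a convolution of natural-number vectors to `ℤ/q`. [folklore] -/
theorem natCast_conv (q : ℕ) (f g : (ZMod p)ˣ → ℕ) (b : (ZMod p)ˣ) :
    ((conv f g b : ℕ) : ZMod q) = conv (fun a => (f a : ZMod q)) (fun a => (g a : ZMod q)) b := by
  simp [conv, Nat.cast_sum, Nat.cast_mul]

/-- **`θ ⋆ e⁺ = θ`** for symmetric `θ` and `e⁺ = ½(δ_1 + δ_{-1})` (`q` odd, `p ≠ 2`). [folklore] -/
theorem conv_eplus (hp2 : p ≠ 2) {q : ℕ} (hq : Odd q) {t : (ZMod p)ˣ → ZMod q} (ht : ∀ b, t (-b) = t b)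
    {e : (ZMod p)ˣ → ZMod q}
    (he : ∀ c, e c = if c = 1 ∨ c = -1 then (((q + 1) / 2 : ℕ) : ZMod q) else 0) :
    conv t e = t := by
  classical
  funext b
  unfold conv
  have hb : b ≠ -b := by
    intro h
    have h2 : (2 : ZMod p) * (b : ZMod p) = 0 := by
      have := congrArg (fun u : (ZMod p)ˣ => (u : ZMod p)) h
      simp only [Units.val_neg] at this
      linear_combination this
    rcases mul_eq_zero.mp h2 with h3 | h3
    · apply hp2
      have : p ∣ 2 := (ZMod.natCast_eq_zero_iff 2 p).mp (by exact_mod_cast h3)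
      exact ((Nat.prime_dvd_prime_iff_eq hp.out Nat.prime_two).mp this)
    · exact b.ne_zero h3
  rw [Finset.sum_eq_add b (-b) hb]
  · have e1 : e (b⁻¹ * b) = (((q + 1) / 2 : ℕ) : ZMod q) := by rw [he, if_pos (Or.inl (inv_mul_cancel b))]
    have e2 : e ((-b)⁻¹ * b) = (((q + 1) / 2 : ℕ) : ZMod q) := by
      rw [he, if_pos (Or.inr (by rw [inv_neg, neg_mul, inv_mul_cancel]))]
    rw [e1, e2, ht, ← add_mul, ← two_mul, mul_comm (2 : ZMod q), mul_assoc]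
    obtain ⟨m, rfl⟩ := hq
    have h1 : (2 * m + 1 + 1) / 2 = m + 1 := by omega
    have h2 : 2 * (((m + 1 : ℕ) : ZMod (2 * m + 1))) = 1 := by
      have : (((2 * m + 1 : ℕ)) : ZMod (2 * m + 1)) = 0 := ZMod.natCast_self _
      push_cast at this ⊢
      linear_combination this
    rw [h1, h2, mul_one]
  · intro c _ hc
    rw [he, if_neg, mul_zero]
    rintro (h | h)
    · rw [inv_mul_eq_iff_eq_mul, mul_one] at h
      exact hc.1 h.symm
    · rw [inv_mul_eq_iff_eq_mul, mul_neg, mul_one] at h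
      exact hc.2 (neg_eq_iff_eq_neg.mp h.symm)
  · intro h; exact absurd (Finset.mem_univ _) h
  · intro h; exact absurd (Finset.mem_univ _) h

/-- **The endgame of [Schoof2009, Theorem 16.3] (abstract form).** Let `θ = ∑ t_b σ_b` be
symmetric, `u` an element of `𝓞 K` prime to `l` with: the index vector of `u^θ` is `k` (`hu`; from
the hypothesis "`u^θ` is a cyclotomic unit times a `q`-th power" and part II), `k` annihilates
`𝔩` modulo `q`-th powers (`hk`; parts II–III), and the index vector of `u^y` is `e⁺ = ½(δ_1 + δ_ι)`
for some `y ∈ ℕ[G]` (`hy`; the choice of the auxiliary prime, [Schoof2009, Lemma 16.2]). Then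
**`θ` annihilates `𝔩` modulo `q`-th powers.** Proof: `(u^θ)^y = (u^y)^θ` has index vectors
`y ⋆ k` and `θ ⋆ e⁺ = θ`, which agree modulo `q`; `Ann` is an ideal.
[cite: Schoof2009, Theorem 16.3 (proof, p. 110)] -/
theorem Ann.of_galPow (hp2 : p ≠ 2) {𝔩 : Ideal (𝓞 K)} [𝔩.IsPrime] {s q : ℕ} [NeZero q] (hq : Odd q)
    (h𝔩 : ∀ b, (gal p K b • 𝔩).IsMaximal) (hs : ∀ b, (s : 𝓞 K) ∉ gal p K b • 𝔩)
    (hsq : ∀ (b : (ZMod p)ˣ) (d : ℕ),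
      (∃ z : 𝓞 K, z ∉ gal p K b • 𝔩 ∧ (s : 𝓞 K) ^ d - z ^ q ∈ gal p K b • 𝔩) → q ∣ d)
    {t y k e : (ZMod p)ˣ → ℕ} {u : 𝓞 K} (ht : ∀ b, t (-b) = t b)
    (hu : Rep 𝔩 s q (galPow t u) k) (hk : Ann 𝔩 q (fun b => (k b : ZMod q)))
    (hy : Rep 𝔩 s q (galPow y u) e)
    (he : ∀ c, (e c : ZMod q) = if c = 1 ∨ c = -1 then (((q + 1) / 2 : ℕ) : ZMod q) else 0) :
    Ann 𝔩 q (fun b => (t b : ZMod q)) := by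
  -- the two index vectors of `(u^θ)^y = (u^y)^θ`
  have h1 : Rep 𝔩 s q (galPow y (galPow t u)) (Thaine.conv y k) := hu.galPow y
  have h2 : Rep 𝔩 s q (galPow y (galPow t u)) (Thaine.conv t e) := by
    rw [galPow_comm]; exact hy.galPow t
  have h3 : ∀ b, ((Thaine.conv y k b : ℕ) : ZMod q) = ((Thaine.conv t e b : ℕ) : ZMod q) :=
    Rep.natCast_eq h𝔩 hs hsq h1 h2
  -- `θ ⋆ e⁺ = θ`
  have h4 : Thaine.conv (fun a => (t a : ZMod q)) (fun a => (e a : ZMod q)) = fun b => (t b : ZMod q) :=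
    conv_eplus hp2 hq (t := fun a => (t a : ZMod q)) (fun b => by simp only [ht]) he
  have h5 : (fun b => (t b : ZMod q)) = Thaine.conv (fun a => (y a : ZMod q)) (fun a => (k a : ZMod q)) := by
    rw [← h4]
    funext b
    rw [← natCast_conv, ← natCast_conv, h3]
  rw [h5]
  have h0 : 𝔩 ≠ ⊥ := by
    have := h𝔩 1
    rw [gal_one, one_smul] at this
    exact Ring.ne_bot_of_isMaximal_of_not_isField this (RingOfIntegers.not_isField K)
  exact hk.conv h0 _

end Endgame

/-! ### Glue: the primes `σ_b(𝔩)` of `K` over the auxiliary prime `l` and the primes of `L` above -/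

section Glue

open IsCyclotomicExtension

variable {p : ℕ} [hp : Fact p.Prime] {K : Type} [Field K] [NumberField K]
  [hK : IsCyclotomicExtension {p} ℚ K]
variable {l : ℕ} [hl : Fact l.Prime]
variable (L : Type) [Field L] [Algebra K L] [hL : IsCyclotomicExtension {l} K L] [CharZero L]
  [NumberField L]
variable (𝔩 : Ideal (𝓞 K)) [h𝔩m : 𝔩.IsMaximal] [h𝔩l : 𝔩.LiesOver (Ideal.span {(l : ℤ)})]

omit hl in
include h𝔩m in
/-- `σ_b(𝔩)` is a maximal ideal. [folklore] -/
theorem isMaximal_smul (b : (ZMod p)ˣ) : (gal p K b • 𝔩).IsMaximal := by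
  have h0 : 𝔩 ≠ ⊥ := Ring.ne_bot_of_isMaximal_of_not_isField h𝔩m (RingOfIntegers.not_isField K)
  refine Ideal.IsPrime.isMaximal inferInstance fun h => h0 ?_
  have := congrArg (fun J : Ideal (𝓞 K) => (gal p K b)⁻¹ • J) h
  simpa using this

omit hl h𝔩m in
include h𝔩l in
/-- `l ∈ σ_b(𝔩)`. [folklore] -/
theorem natCast_mem_smul (b : (ZMod p)ˣ) : ((l : ℤ) : 𝓞 K) ∈ gal p K b • 𝔩 := by
  have h1 : ((l : ℤ) : 𝓞 K) ∈ 𝔩 := by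
    have : (l : ℤ) ∈ (Ideal.span {(l : ℤ)} : Ideal ℤ) := Ideal.mem_span_singleton_self _
    have h2 := (Ideal.mem_of_liesOver 𝔩 (Ideal.span {(l : ℤ)}) (l : ℤ)).mp this
    simpa using h2
  have e : gal p K b • (((l : ℤ) : 𝓞 K)) = ((l : ℤ) : 𝓞 K) := by
    have := map_intCast (MulSemiringAction.toRingHom Gal(K/ℚ) (𝓞 K) (gal p K b)) (l : ℤ)
    rwa [MulSemiringAction.toRingHom_apply] at this
  have := (Ideal.smul_mem_pointwise_smul_iff (a := gal p K b)).mpr h1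
  rwa [e] at this

omit hl in
include h𝔩m in
/-- **the prime `𝔏_b` of `L` over `σ_b(𝔩)`** (unique, `CatalanThaineField`). [cite: Schoof2009, §16 (p. 110)] -/
noncomputable def primeOver (b : (ZMod p)ˣ) : Ideal (𝓞 L) :=
  haveI := isMaximal_smul (K := K) 𝔩 b
  Classical.choose (Ideal.exists_maximal_ideal_liesOver_of_isIntegral (S := 𝓞 L) (gal p K b • 𝔩))

omit hl [CharZero L] [NumberField L] in
include h𝔩m in
/-- `𝔏_b` is maximal. [folklore] -/
theorem primeOver_isMaximal (b : (ZMod p)ˣ) : (primeOver (K := K) L 𝔩 b).IsMaximal := by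
  haveI := isMaximal_smul (K := K) 𝔩 b
  exact (Classical.choose_spec
    (Ideal.exists_maximal_ideal_liesOver_of_isIntegral (S := 𝓞 L) (gal p K b • 𝔩))).1

omit hl [CharZero L] [NumberField L] in
include h𝔩m in
/-- `𝔏_b` lies over `σ_b(𝔩)`. [folklore] -/
theorem primeOver_liesOver (b : (ZMod p)ˣ) : (primeOver (K := K) L 𝔩 b).LiesOver (gal p K b • 𝔩) := by
  haveI := isMaximal_smul (K := K) 𝔩 b
  exact (Classical.choose_spec
    (Ideal.exists_maximal_ideal_liesOver_of_isIntegral (S := 𝓞 L) (gal p K b • 𝔩))).2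

/-! ### G1: the index vector of a cyclotomic unit (part II) -/

include hK hL h𝔩m h𝔩l in
/-- **the index vector of `γ = cycElt` is `(l-2) · r`, `r_b = v_{𝔏_b}(α)`** — the congruences
`γ s^{r_b} ≡ 1 (mod σ_b 𝔩)` of part II (`mul_pow_val_sub_one_mem`) together with Fermat
`s^{l-1} ≡ 1`. [cite: Schoof2009, Theorem 16.3 (proof, p. 110: "`γ ≡ s^{r_σ} (mod σ(𝔩))`")] -/
theorem rep_cycElt (hpl : p ≠ l) (τ : Gal(L/K)) (q : ℕ) {ζ : K} (hζ : IsPrimitiveRoot ζ p)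
    {α : 𝓞 L} (hα : α ≠ 0) (e₀ e₁ : ℕ) (n : (ZMod p)ˣ → ℕ)
    (h : claimElt (l := l) L hζ e₀ e₁ n * τ • α = α) :
    Rep 𝔩 ((galEquiv L hpl τ : (ZMod l)ˣ) : ZMod l).val q (cycElt hζ e₀ e₁ n)
      (fun b : (ZMod p)ˣ => (l - 2) * val (primeOver (K := K) L 𝔩 b) α) := by
  haveI : NeZero l := ⟨hl.out.ne_zero⟩
  have hl' := hl.out
  set s : ℕ := ((galEquiv L hpl τ : (ZMod l)ˣ) : ZMod l).val with hs
  set γ : 𝓞 K := cycElt hζ e₀ e₁ n with hγ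
  -- Fermat: `l ∣ s^{l-1} - 1`
  have hsl : ((s : ℕ) : ZMod l) ≠ 0 := by
    rw [hs, ZMod.natCast_zmod_val]; exact Units.ne_zero _
  have hferm : ∃ m : ℕ, s ^ (l - 1) = l * m + 1 := by
    have h1 : ((s ^ (l - 1) : ℕ) : ZMod l) = ((1 : ℕ) : ZMod l) := by
      rw [Nat.cast_pow, ZMod.pow_card_sub_one_eq_one hsl, Nat.cast_one]
    rw [ZMod.natCast_eq_natCast_iff] at h1
    have h2 : 1 ≤ s ^ (l - 1) := Nat.one_le_pow _ _ (ZMod.val_pos.mpr (Units.ne_zero _))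
    obtain ⟨m, hm⟩ := (Nat.modEq_iff_dvd' h2).mp h1.symm
    exact ⟨m, by omega⟩
  obtain ⟨m, hm⟩ := hferm
  intro b
  haveI := isMaximal_smul (K := K) 𝔩 b
  haveI := primeOver_isMaximal (K := K) L 𝔩 b
  haveI := primeOver_liesOver (K := K) L 𝔩 b
  -- part II: `γ s^r ≡ 1 (mod σ_b 𝔩)`
  have hcong := mul_pow_val_sub_one_mem (gal p K b • 𝔩) (primeOver (K := K) L 𝔩 b) hpl τ hα h
    (claimElt_sub_cycElt_mem L hζ e₀ e₁ n)
  set r : ℕ := val (primeOver (K := K) L 𝔩 b) α with hr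
  -- `s^{l-1} ≡ 1 (mod σ_b 𝔩)`
  have hsl1 : (s : 𝓞 K) ^ (l - 1) - 1 ∈ gal p K b • 𝔩 := by
    have e : (s : 𝓞 K) ^ (l - 1) - 1 = ((l : ℤ) : 𝓞 K) * (m : 𝓞 K) := by
      have := congrArg (fun k : ℕ => (k : 𝓞 K)) hm
      push_cast at this ⊢
      linear_combination this
    rw [e]
    exact Ideal.mul_mem_right _ _ (natCast_mem_smul (K := K) 𝔩 b)
  refine ⟨1, fun h1 => (isMaximal_smul (K := K) 𝔩 b).ne_top ((Ideal.eq_top_iff_one _).mpr h1), ?_⟩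
  -- `γ - s^{(l-2) r} = γ (1 - s^{(l-1) r}) + s^{(l-2) r} (γ s^r - 1)`
  obtain ⟨l2, hl2⟩ : ∃ l2 : ℕ, l - 2 = l2 ∧ l - 1 = l2 + 1 := ⟨l - 2, rfl, by have := hl'.two_le; omega⟩
  obtain ⟨c, hc⟩ := sub_dvd_pow_sub_pow (1 : 𝓞 K) ((s : 𝓞 K) ^ (l - 1)) r
  have e : γ - (s : 𝓞 K) ^ ((l - 2) * r) * 1 ^ q =
      γ * (1 ^ r - ((s : 𝓞 K) ^ (l - 1)) ^ r) + (s : 𝓞 K) ^ ((l - 2) * r) * (γ * (s : 𝓞 K) ^ r - 1) := by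
    rw [hl2.1, hl2.2, ← pow_mul]
    ring
  rw [e, hc]
  refine Ideal.add_mem _ (Ideal.mul_mem_left _ _ (Ideal.mul_mem_right _ _ ?_)) (Ideal.mul_mem_left _ _ hcong)
  rw [← neg_sub]
  exact (gal p K b • 𝔩).neg_mem hsl1

/-! ### G2: the primes of `L` over `l` are the `𝔏_b`, and `b ↦ σ_b(𝔩)` is injective -/

include hK h𝔩l in
omit hl in
/-- every prime of `K` over `l` is a `σ_b(𝔩)` (transitivity of `Gal(K/ℚ)`). [folklore] -/
theorem exists_eq_smul [Fact l.Prime] (𝔭 : Ideal (𝓞 K)) [𝔭.IsMaximal] (h𝔭 : ((l : ℤ) : 𝓞 K) ∈ 𝔭) :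
    ∃ b : (ZMod p)ˣ, 𝔭 = gal p K b • 𝔩 := by
  haveI : IsGalois ℚ K := IsCyclotomicExtension.isGalois {p} ℚ K
  -- `𝔭` lies over `l`
  haveI : 𝔭.LiesOver (Ideal.span {(l : ℤ)}) := by
    refine ⟨(Ideal.IsMaximal.eq_of_le ?_ ?_ ?_)⟩
    · exact Ideal.IsPrime.isMaximal (Ideal.span_singleton_prime (by exact_mod_cast (Fact.out : l.Prime).ne_zero)
        |>.mpr (Nat.prime_iff_prime_int.mp Fact.out)) (by
          rw [Ne, Ideal.span_singleton_eq_bot]; exact_mod_cast (Fact.out : l.Prime).ne_zero)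
    · exact Ideal.comap_ne_top _ (Ideal.IsMaximal.ne_top inferInstance)
    · rw [Ideal.span_singleton_le_iff_mem, Ideal.under_def, Ideal.mem_comap, eq_intCast]
      exact h𝔭
  obtain ⟨σ, hσ⟩ := Ideal.exists_smul_eq_of_isGaloisGroup (Ideal.span {(l : ℤ)}) 𝔩 𝔭 Gal(K/ℚ)
  refine ⟨Rat.galEquivZMod p K σ, ?_⟩
  rw [← hσ, gal, MulEquiv.symm_apply_apply]

include hK h𝔩m h𝔩l in
/-- **`b ↦ σ_b(𝔩)` is injective**: `l ≡ 1 (mod p)` splits completely in `K` (`e = f = 1`, so there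
are `p - 1 = #G` primes over `l`). [cite: Washington1997, Thm. 2.13] -/
theorem smul_injective (hpl : p ≠ l) (hl1 : p ∣ l - 1) :
    Function.Injective fun b : (ZMod p)ˣ => gal p K b • 𝔩 := by
  classical
  haveI : IsGalois ℚ K := IsCyclotomicExtension.isGalois {p} ℚ K
  haveI : NeZero p := ⟨hp.out.ne_zero⟩
  -- the map to the primes over `l` is surjective between sets of the same size `p - 1`
  let f : (ZMod p)ˣ → (Ideal.span {(l : ℤ)} : Ideal ℤ).primesOver (𝓞 K) :=
    fun b => ⟨gal p K b • 𝔩, inferInstance, inferInstance⟩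
  have hsurj : Function.Surjective f := by
    rintro ⟨𝔭, h𝔭p, h𝔭l⟩
    haveI := h𝔭p
    haveI := h𝔭l
    have h0 : 𝔭 ≠ ⊥ := Ideal.ne_bot_of_liesOver_of_ne_bot (p := Ideal.span {(l : ℤ)})
      (by rw [Ne, Ideal.span_singleton_eq_bot]; exact_mod_cast hl.out.ne_zero) 𝔭
    haveI : 𝔭.IsMaximal := Ideal.IsPrime.isMaximal h𝔭p h0
    have hmem : ((l : ℤ) : 𝓞 K) ∈ 𝔭 := by
      have := (Ideal.mem_of_liesOver 𝔭 (Ideal.span {(l : ℤ)}) (l : ℤ)).mp (Ideal.mem_span_singleton_self _)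
      simpa using this
    obtain ⟨b, hb⟩ := exists_eq_smul (p := p) (K := K) 𝔩 𝔭 hmem
    exact ⟨b, Subtype.ext hb.symm⟩
  have hcard : Nat.card (ZMod p)ˣ = Nat.card ((Ideal.span {(l : ℤ)} : Ideal ℤ).primesOver (𝓞 K)) := by
    have h := Ideal.ncard_primesOver_mul_ramificationIdxIn_mul_inertiaDegIn
      (Ideal.span {(l : ℤ)} : Ideal ℤ) (𝓞 K) Gal(K/ℚ)
    rw [ramificationIdxIn_base (K := K) hpl, inertiaDegIn_base (K := K) hpl, one_mul,
      IsGalois.card_aut_eq_finrank, IsCyclotomicExtension.finrank K (Polynomial.cyclotomic.irreducible_rat hp.out.pos),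
      Nat.totient_prime hp.out] at h
    have hl1' : orderOf ((l : ℕ) : ZMod p) = 1 := by
      rw [orderOf_eq_one_iff]
      have : ((l : ℕ) : ZMod p) = ((1 : ℕ) : ZMod p) :=
        (ZMod.natCast_eq_natCast_iff _ _ _).mpr ((Nat.modEq_iff_dvd' hl.out.one_lt.le).mpr hl1).symm
      simpa using this
    rw [hl1', mul_one] at h
    rw [Nat.card_eq_fintype_card, ZMod.card_units, Nat.card_coe_set_eq, h]
  obtain ⟨e⟩ := Finite.card_eq.mp hcard
  have hinj : Function.Injective f := (Finite.injective_iff_surjective_of_equiv e).mpr hsurj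
  intro b b' h
  exact hinj (Subtype.ext h)

include hK hL h𝔩m h𝔩l in
/-- **every prime of `L` containing `l` is one of the `𝔏_b`.** [folklore] -/
theorem exists_eq_primeOver (hpl : p ≠ l) (𝔓 : Ideal (𝓞 L)) [𝔓.IsMaximal] (h𝔓 : ((l : ℤ) : 𝓞 L) ∈ 𝔓) :
    ∃ b : (ZMod p)ˣ, 𝔓 = primeOver (K := K) L 𝔩 b := by
  set 𝔭 : Ideal (𝓞 K) := 𝔓.under (𝓞 K) with h𝔭
  haveI : 𝔭.IsMaximal := Ideal.IsMaximal.under (𝓞 K) 𝔓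
  haveI : 𝔓.LiesOver 𝔭 := ⟨rfl⟩
  have hmem : ((l : ℤ) : 𝓞 K) ∈ 𝔭 := by
    rw [h𝔭, Ideal.under_def, Ideal.mem_comap, map_intCast]
    exact h𝔓
  obtain ⟨b, hb⟩ := exists_eq_smul (p := p) (K := K) 𝔩 𝔭 hmem
  refine ⟨b, ?_⟩
  haveI := isMaximal_smul (K := K) 𝔩 b
  haveI := primeOver_isMaximal (K := K) L 𝔩 b
  haveI := primeOver_liesOver (K := K) L 𝔩 b
  haveI : 𝔓.LiesOver (gal p K b • 𝔩) := by rw [← hb]; infer_instance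
  exact eq_of_liesOver (gal p K b • 𝔩) (primeOver (K := K) L 𝔩 b) hpl 𝔓

include hK h𝔩m h𝔩l in
omit hL [CharZero L] [NumberField L] in
/-- `b ↦ 𝔏_b` is injective. [folklore] -/
theorem primeOver_injective (hpl : p ≠ l) (hl1 : p ∣ l - 1) :
    Function.Injective (primeOver (p := p) (K := K) L 𝔩) := by
  intro b b' h
  apply smul_injective (K := K) 𝔩 hpl hl1
  haveI := primeOver_liesOver (K := K) L 𝔩 b
  haveI := primeOver_liesOver (K := K) L 𝔩 b'
  have h1 := (primeOver_liesOver (K := K) L 𝔩 b).over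
  have h2 := (primeOver_liesOver (K := K) L 𝔩 b').over
  simp only at h1 h2 ⊢
  rw [h1, h2, h]

include hK hL h𝔩m h𝔩l in
/-- **the part of `(α)` over `l`, normed down: `∏_{𝔓 ∋ l} N(𝔓)^{v_𝔓(α)} = ∏_b σ_b(𝔩)^{v_{𝔏_b}(α)}`.**
[cite: Schoof2009, Theorem 16.3 (proof, p. 110: "`(N(α)) = J^{l-1} ∏_σ σ(𝔩)^{r_σ}`")] -/
theorem prod_filter_map_relNorm_eq (hpl : p ≠ l) (hl1 : p ∣ l - 1)
    [DecidablePred fun 𝔓 : Ideal (𝓞 L) => ((l : ℤ) : 𝓞 L) ∈ 𝔓] {α : 𝓞 L} (hα : α ≠ 0) :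
    (((UniqueFactorizationMonoid.normalizedFactors (Ideal.span {α})).filter
        (fun 𝔓 => ((l : ℤ) : 𝓞 L) ∈ 𝔓)).map (relNorm (𝓞 K))).prod =
      ∏ b, (gal p K b • 𝔩) ^ val (primeOver (K := K) L 𝔩 b) α := by
  classical
  set F := UniqueFactorizationMonoid.normalizedFactors (Ideal.span {α} : Ideal (𝓞 L)) with hF
  -- the right-hand side over the image of `b ↦ 𝔏_b`
  have hR : ∀ b, (gal p K b • 𝔩) ^ val (primeOver (K := K) L 𝔩 b) α =
      relNorm (𝓞 K) (primeOver (K := K) L 𝔩 b) ^ F.count (primeOver (K := K) L 𝔩 b) := by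
    intro b
    haveI := isMaximal_smul (K := K) 𝔩 b
    haveI := primeOver_isMaximal (K := K) L 𝔩 b
    haveI := primeOver_liesOver (K := K) L 𝔩 b
    rw [relNorm_eq (gal p K b • 𝔩) (primeOver (K := K) L 𝔩 b) hpl]
    simp only [val, hF]
  rw [Finset.prod_congr rfl fun b _ => hR b,
    ← Finset.prod_image (s := Finset.univ) (g := primeOver (K := K) L 𝔩)
      (f := fun 𝔓 => relNorm (𝓞 K) 𝔓 ^ F.count 𝔓)
      (fun b _ b' _ h => primeOver_injective (K := K) L 𝔩 hpl hl1 h),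
    Finset.prod_multiset_map_count]
  -- compare the products over `S = (F.filter C).toFinset ⊆ T = im 𝔏`
  have hcount : ∀ 𝔓 ∈ (F.filter fun 𝔓 => ((l : ℤ) : 𝓞 L) ∈ 𝔓).toFinset,
      relNorm (𝓞 K) 𝔓 ^ (F.filter fun 𝔓 => ((l : ℤ) : 𝓞 L) ∈ 𝔓).count 𝔓 =
        relNorm (𝓞 K) 𝔓 ^ F.count 𝔓 := by
    intro 𝔓 h𝔓
    rw [Multiset.mem_toFinset, Multiset.mem_filter] at h𝔓
    rw [Multiset.count_filter_of_pos (p := fun 𝔓 => ((l : ℤ) : 𝓞 L) ∈ 𝔓) h𝔓.2]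
  rw [Finset.prod_congr rfl hcount]
  apply Finset.prod_subset
  · intro 𝔓 h𝔓
    rw [Multiset.mem_toFinset, Multiset.mem_filter] at h𝔓
    have hsp : (Ideal.span {α} : Ideal (𝓞 L)) ≠ ⊥ := by rw [Ne, Ideal.span_singleton_eq_bot]; exact hα
    haveI : 𝔓.IsMaximal :=
      (Ideal.isPrime_of_prime (UniqueFactorizationMonoid.prime_of_normalized_factor 𝔓 h𝔓.1)).isMaximal
        (UniqueFactorizationMonoid.ne_zero_of_mem_normalizedFactors h𝔓.1)
    obtain ⟨b, hb⟩ := exists_eq_primeOver (K := K) L 𝔩 hpl 𝔓 h𝔓.2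
    exact Finset.mem_image.mpr ⟨b, Finset.mem_univ _, hb.symm⟩
  · intro 𝔓 hT hS
    obtain ⟨b, -, rfl⟩ := Finset.mem_image.mp hT
    have hC : ((l : ℤ) : 𝓞 L) ∈ primeOver (K := K) L 𝔩 b := by
      haveI := primeOver_liesOver (K := K) L 𝔩 b
      have := (Ideal.mem_of_liesOver (primeOver (K := K) L 𝔩 b) (gal p K b • 𝔩) ((l : ℤ) : 𝓞 K)).mp
        (natCast_mem_smul (K := K) (l := l) 𝔩 b)
      simpa using this
    have hnot : primeOver (K := K) L 𝔩 b ∉ F := fun hF' =>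
      hS (Multiset.mem_toFinset.mpr (Multiset.mem_filter.mpr ⟨hF', hC⟩))
    rw [Multiset.count_eq_zero_of_notMem hnot, pow_zero]

include hK hL h𝔩m h𝔩l in
/-- **G2: `r = (v_{𝔏_b}(α))_b` annihilates `𝔩` modulo `q`-th powers** — the norm computation
`(N α) = 𝔟^{l-1} ∏_b σ_b(𝔩)^{r_b}` of part III with `q ∣ l - 1`.
[cite: Schoof2009, Theorem 16.3 (proof, p. 110)] -/
theorem ann_val (hpl : p ≠ l) (hl1 : p ∣ l - 1) {q : ℕ} [NeZero q] (hlq : q ∣ l - 1) {τ : Gal(L/K)}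
    (hτ : ∀ x, x ∈ Subgroup.zpowers τ) {ε α : 𝓞 L} (hε : IsUnit ε) (hα : α ≠ 0) (h : ε * τ • α = α) :
    Ann 𝔩 q (fun b : (ZMod p)ˣ => (val (primeOver (K := K) L 𝔩 b) α : ZMod q)) := by
  classical
  obtain ⟨𝔟, h𝔟⟩ := exists_relNorm_span_eq (K := K) (L := L) hpl hτ hε hα h
  rw [prod_filter_map_relNorm_eq (K := K) L 𝔩 hpl hl1 hα, Ideal.relNorm_singleton] at h𝔟
  obtain ⟨d, hd⟩ := hlq
  have hN : Algebra.intNorm (𝓞 K) (𝓞 L) α ≠ 0 := by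
    intro h0
    have : relNorm (𝓞 K) (Ideal.span {α} : Ideal (𝓞 L)) = ⊥ := by
      rw [Ideal.relNorm_singleton, h0, Ideal.span_singleton_eq_bot]
    rw [Ideal.relNorm_eq_bot_iff, Ideal.span_singleton_eq_bot] at this
    exact hα this
  have h0 : 𝔩 ≠ ⊥ := Ring.ne_bot_of_isMaximal_of_not_isField h𝔩m (RingOfIntegers.not_isField K)
  have h𝔟0 : 𝔟 ≠ ⊥ := by
    rintro rfl
    have hl2 := hl.out.two_le
    have e0 : (⊥ : Ideal (𝓞 K)) ^ (l - 1) = ⊥ := by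
      rw [← Ideal.zero_eq_bot, zero_pow (by omega)]
    have h' := h𝔟
    rw [e0, Ideal.bot_mul] at h'
    exact hN (Ideal.span_singleton_eq_bot.mp h')
  refine Ann.of_nat h0 (β₁ := 1) (β₂ := Algebra.intNorm (𝓞 K) (𝓞 L) α) (J₁ := 𝔟 ^ d) (J₂ := 1)
    one_ne_zero hN (pow_ne_bot' h𝔟0 d) (by rw [Ideal.one_eq_top]; exact top_ne_bot) ?_
  rw [Ideal.span_singleton_one, Ideal.top_mul, one_pow, mul_one, ← pow_mul, mul_comm d q, ← hd]
  exact h𝔟.symm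

/-! ### The residue fields `𝓞 K / σ_b(𝔩) ≅ ℤ/l` and the primitive root `s` -/

omit hl in
include h𝔩m in
/-- units are prime to `l`. [folklore] -/
theorem not_mem_smul_of_isUnit {x : 𝓞 K} (hx : IsUnit x) (b : (ZMod p)ˣ) : x ∉ gal p K b • 𝔩 :=
  fun h => (isMaximal_smul (K := K) 𝔩 b).ne_top (Ideal.eq_top_of_isUnit_mem _ h hx)

include hK h𝔩m h𝔩l in
/-- **`π = ζ - 1` is prime to `l`** (`π ∣ p`, `gcd(p, l) = 1`). [folklore] -/
theorem toInteger_sub_one_not_mem_smul (hpl : p ≠ l) {ζ : K} (hζ : IsPrimitiveRoot ζ p) (b : (ZMod p)ˣ) :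
    hζ.toInteger - 1 ∉ gal p K b • 𝔩 := by
  intro h
  have hpmem : ((p : ℤ) : 𝓞 K) ∈ gal p K b • 𝔩 := by
    obtain ⟨c, hc⟩ := hζ.toInteger_sub_one_dvd_prime'
    have : ((p : ℕ) : 𝓞 K) = (hζ.toInteger - 1) * c := hc
    rw [Int.cast_natCast, this]
    exact Ideal.mul_mem_right _ _ h
  have hcop : IsCoprime (p : ℤ) (l : ℤ) :=
    (Nat.isCoprime_iff_coprime.mpr ((Nat.coprime_primes hp.out hl.out).mpr hpl))
  obtain ⟨a, c, hac⟩ := hcop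
  apply (isMaximal_smul (K := K) 𝔩 b).ne_top
  rw [Ideal.eq_top_iff_one]
  have e : (1 : 𝓞 K) = (a : 𝓞 K) * ((p : ℤ) : 𝓞 K) + (c : 𝓞 K) * ((l : ℤ) : 𝓞 K) := by
    have := congrArg (fun z : ℤ => (z : 𝓞 K)) hac
    push_cast at this ⊢
    linear_combination -this
  rw [e]
  exact Ideal.add_mem _ (Ideal.mul_mem_left _ _ hpmem) (Ideal.mul_mem_left _ _ (natCast_mem_smul (l := l) 𝔩 b))

omit hl h𝔩m in
include h𝔩l in
/-- an integer prime to `l` is prime to every `σ_b(𝔩)`. [folklore] -/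
theorem natCast_not_mem_smul {s : ℕ} (hs : ¬ l ∣ s) (b : (ZMod p)ˣ) : ((s : ℕ) : 𝓞 K) ∉ gal p K b • 𝔩 := by
  intro h
  apply hs
  have h1 : (s : ℤ) ∈ (Ideal.span {(l : ℤ)} : Ideal ℤ) := by
    rw [Ideal.mem_of_liesOver (gal p K b • 𝔩) (Ideal.span {(l : ℤ)}) (s : ℤ)]
    simpa using h
  rw [Ideal.mem_span_singleton] at h1
  exact_mod_cast h1

include hK h𝔩m h𝔩l in
/-- **`#(𝓞 K / σ_b(𝔩)) = l`** for `l ≡ 1 (mod p)` (`f = 1`). [cite: Washington1997, Thm. 2.13] -/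
theorem card_quot_smul (hpl : p ≠ l) (hl1 : p ∣ l - 1) (b : (ZMod p)ˣ) :
    Nat.card (𝓞 K ⧸ gal p K b • 𝔩) = l := by
  haveI : IsGalois ℚ K := IsCyclotomicExtension.isGalois {p} ℚ K
  haveI := isMaximal_smul (K := K) 𝔩 b
  have h1 := Ideal.absNorm_eq_pow_inertiaDeg' (gal p K b • 𝔩) hl.out
  rw [Ideal.inertiaDeg'_eq_inertiaDeg, ← Ideal.inertiaDegIn_eq_inertiaDeg (Ideal.span {(l : ℤ)}) (gal p K b • 𝔩) Gal(K/ℚ),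
    inertiaDegIn_base (K := K) hpl] at h1
  have hl1' : orderOf ((l : ℕ) : ZMod p) = 1 := by
    rw [orderOf_eq_one_iff]
    have : ((l : ℕ) : ZMod p) = ((1 : ℕ) : ZMod p) :=
      (ZMod.natCast_eq_natCast_iff _ _ _).mpr ((Nat.modEq_iff_dvd' hl.out.one_lt.le).mpr hl1).symm
    simpa using this
  rw [hl1', pow_one, Ideal.absNorm_apply, Submodule.cardQuot_apply] at h1
  exact h1

include hK hL h𝔩m h𝔩l in
omit [NumberField L] in
/-- **`s` is a primitive root modulo every `σ_b(𝔩)`, so `s^d` is a `q`-th power residue only if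
`q ∣ d`** (`q ∣ l - 1`): the hypothesis `hsq` of the endgame. [cite: Schoof2009, §16 (p. 109:
"a fixed primitive root modulo `𝔩`")] -/
theorem dvd_of_pow_sub_pow_mem (hpl : p ≠ l) (hl1 : p ∣ l - 1) {q : ℕ} (hlq : q ∣ l - 1)
    {τ : Gal(L/K)} (hτ : ∀ x, x ∈ Subgroup.zpowers τ) (b : (ZMod p)ˣ) (d : ℕ)
    (h : ∃ z : 𝓞 K, z ∉ gal p K b • 𝔩 ∧
      ((((galEquiv L hpl τ : (ZMod l)ˣ) : ZMod l).val : ℕ) : 𝓞 K) ^ d - z ^ q ∈ gal p K b • 𝔩) :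
    q ∣ d := by
  classical
  haveI : NeZero l := ⟨hl.out.ne_zero⟩
  haveI := isMaximal_smul (K := K) 𝔩 b
  obtain ⟨z, hz, hmem⟩ := h
  set u : (ZMod l)ˣ := galEquiv L hpl τ with hu
  -- the residue field has `l` elements: identify it with `ZMod l`
  have hcard := card_quot_smul (K := K) 𝔩 hpl hl1 b
  haveI : Finite (𝓞 K ⧸ gal p K b • 𝔩) := Nat.finite_of_card_ne_zero (by rw [hcard]; exact hl.out.ne_zero)
  letI : Fintype (𝓞 K ⧸ gal p K b • 𝔩) := Fintype.ofFinite _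
  letI : Field (𝓞 K ⧸ gal p K b • 𝔩) := Ideal.Quotient.field _
  have hcard' : Fintype.card (𝓞 K ⧸ gal p K b • 𝔩) = l := by rw [Fintype.card_eq_nat_card, hcard]
  let ι : ZMod l ≃+* 𝓞 K ⧸ gal p K b • 𝔩 := ZMod.ringEquivOfPrime _ hl.out hcard'
  -- in `ZMod l`: `u^d = x^q` with `x ≠ 0`
  set x : ZMod l := ι.symm (Ideal.Quotient.mk (gal p K b • 𝔩) z) with hx
  have hx0 : x ≠ 0 := by
    intro h0
    apply hz
    rw [← Ideal.Quotient.eq_zero_iff_mem]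
    have := congrArg ι h0
    rwa [hx, RingEquiv.apply_symm_apply, map_zero] at this
  have hrel : ((u : ZMod l)) ^ d = x ^ q := by
    apply ι.injective
    rw [map_pow, map_pow, hx, RingEquiv.apply_symm_apply, ← ZMod.natCast_zmod_val (u : ZMod l),
      map_natCast, ← map_natCast (Ideal.Quotient.mk (gal p K b • 𝔩)), ← map_pow, ← map_pow,
      Ideal.Quotient.eq]
    exact hmem
  -- `x` is a power of the generator `u`
  have hgen : ∀ w : (ZMod l)ˣ, w ∈ Subgroup.zpowers u := by
    intro w
    obtain ⟨k, hk⟩ := Subgroup.mem_zpowers_iff.mp (hτ ((galEquiv L hpl).symm w))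
    refine Subgroup.mem_zpowers_iff.mpr ⟨k, ?_⟩
    rw [hu, ← map_zpow, hk, MulEquiv.apply_symm_apply]
  obtain ⟨j, hj⟩ := Subgroup.mem_zpowers_iff.mp (hgen (Units.mk0 x hx0))
  have hord : orderOf u = l - 1 := by
    rw [orderOf_eq_card_of_forall_mem_zpowers hgen, Nat.card_eq_fintype_card, ZMod.card_units]
  -- `u^d = u^{q j}` so `l - 1 ∣ d - q j`
  have h2 : (u : ZMod l) ^ (d : ℤ) = (u : ZMod l) ^ (q * j : ℤ) := by
    have hj' : (u : ZMod l) ^ j = x := by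
      have := congrArg (fun w : (ZMod l)ˣ => (w : ZMod l)) hj
      simpa [Units.val_zpow_eq_zpow_val] using this
    rw [zpow_natCast, hrel, mul_comm, zpow_mul, zpow_natCast, hj']
  have h3 : u ^ (d : ℤ) = u ^ (q * j : ℤ) := Units.ext (by push_cast; exact h2)
  rw [← mul_inv_eq_one, ← zpow_neg, ← zpow_add, ← orderOf_dvd_iff_zpow_eq_one, hord] at h3
  -- `q ∣ l - 1 ∣ d - q j`
  have h4 : (q : ℤ) ∣ (d : ℤ) := by
    have h5 : (q : ℤ) ∣ (d : ℤ) + -(q * j) := (Int.natCast_dvd_natCast.mpr hlq).trans h3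
    have h6 : (q : ℤ) ∣ (q : ℤ) * j := dvd_mul_right _ _
    have := dvd_add h5 h6
    rwa [neg_add_cancel_right] at this
  exact Int.natCast_dvd_natCast.mp h4

/-! ### Theorem 16.3 for the auxiliary prime -/

include hK hL h𝔩m h𝔩l in
/-- **[Schoof2009, Theorem 16.3] for a given auxiliary prime** (Thaine's theorem, the core).
Let `p` be an odd prime, `K = ℚ(ζ_p)`, `q` odd, `θ = ∑_b t_b σ_b ∈ ℕ[G]` symmetric (`t_{-b} = t_b`),
and `u₀ ∈ 𝓞 K` with **`u₀^θ · w^q = γ · v^q`** for a cyclotomic unit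
`γ = (-1)^{e₀} ζ^{e₁} ∏_a (ζ^a - 1)^{n_a}` and `v, w` prime to `l` (*"`θ` annihilates `u₀` in
`E/C E^q`"*). Let `l ≡ 1 (mod p)`, `q ∣ l - 1`, be a prime with a prime `𝔩 ∣ l` of `K`, `L = K(ζ_l)`
with `Gal(L/K) = ⟨τ⟩`, `τ(ζ_l) = ζ_l^s`, such that `s` is a primitive root modulo every `σ_b(𝔩)`
in the sense of `hs`, `hsq`, and such that **some `u₀^y` has index vector `½(δ_1 + δ_ι)`** (the
auxiliary prime of [Schoof2009, Lemma 16.2]: `E⁺/E⁺^q ≅ (O/l)^*/q` with `u₀` a generator). Then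
**`∏_b σ_b(𝔩)^{t_b}` is a principal ideal times a `q`-th power**: `θ` annihilates the class of `𝔩`
in `Cl_K/Cl_K^q`. Proof = parts II–IV: the Claim and Hilbert 90 give `α` with
`γ s^{r_b} ≡ 1 (mod σ_b 𝔩)`, `r_b = v_{𝔏_b}(α)` (`rep_cycElt`); the norm of `(α)` gives
`r ∈ Ann` (`ann_val`); the endgame `Ann.of_galPow` concludes.
[cite: Schoof2009, Theorem 16.3 (proof, pp. 109–110)] [cite: Washington1997, Thm. 15.2] -/
theorem ann_of_galPow_mul_pow_eq (hp2 : p ≠ 2) {q : ℕ} [NeZero q] (hq : Odd q) (hpl : p ≠ l)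
    (hl1 : p ∣ l - 1) (hlq : q ∣ l - 1) {τ : Gal(L/K)} (hτ : ∀ x, x ∈ Subgroup.zpowers τ)
    (hs : ∀ b, ((((galEquiv L hpl τ : (ZMod l)ˣ) : ZMod l).val : ℕ) : 𝓞 K) ∉ gal p K b • 𝔩)
    (hsq : ∀ (b : (ZMod p)ˣ) (d : ℕ),
      (∃ z : 𝓞 K, z ∉ gal p K b • 𝔩 ∧
        ((((galEquiv L hpl τ : (ZMod l)ˣ) : ZMod l).val : ℕ) : 𝓞 K) ^ d - z ^ q ∈ gal p K b • 𝔩) → q ∣ d)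
    {ζ : K} (hζ : IsPrimitiveRoot ζ p) {t : (ZMod p)ˣ → ℕ} (ht : ∀ b, t (-b) = t b)
    {u₀ v w : 𝓞 K} (hv : ∀ b, v ∉ gal p K b • 𝔩) (hw : ∀ b, w ∉ gal p K b • 𝔩)
    {e₀ e₁ : ℕ} {n : (ZMod p)ˣ → ℕ} (H : galPow t u₀ * w ^ q = cycElt hζ e₀ e₁ n * v ^ q)
    {y e : (ZMod p)ˣ → ℕ} (hy : Rep 𝔩 ((galEquiv L hpl τ : (ZMod l)ˣ) : ZMod l).val q (galPow y u₀) e)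
    (he : ∀ c, (e c : ZMod q) = if c = 1 ∨ c = -1 then (((q + 1) / 2 : ℕ) : ZMod q) else 0) :
    Ann 𝔩 q (fun b : (ZMod p)ˣ => (t b : ZMod q)) := by
  haveI : NeZero l := ⟨hl.out.ne_zero⟩
  haveI := isGalois (K := K) (l := l) L
  haveI := finiteDimensional (K := K) (l := l) L
  set s : ℕ := ((galEquiv L hpl τ : (ZMod l)ˣ) : ZMod l).val with hs'
  -- the Claim and Hilbert 90
  set η : 𝓞 L := claimElt (l := l) L hζ e₀ e₁ n with hη
  have hnorm : Algebra.norm K ((η : 𝓞 L) : L) = 1 := norm_claimElt L hζ hpl hl1 e₀ e₁ n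
  obtain ⟨α, hα0, hα⟩ := exists_mul_smul_eq (K := K) (L := L) hpl hτ hnorm
  have hεu : IsUnit η := by
    rw [← RingOfIntegers.isUnit_norm_of_isGalois K]
    have h1 : RingOfIntegers.norm K η = 1 := RingOfIntegers.ext (by
      rw [RingOfIntegers.coe_norm, hnorm]; rfl)
    rw [h1]
    exact isUnit_one
  have h𝔩max : ∀ b, (gal p K b • 𝔩).IsMaximal := fun b => isMaximal_smul (K := K) 𝔩 b
  -- G1/G2: the index vector `k = (l-2) r` of `γ` and `k ∈ Ann`
  have hk_rep := rep_cycElt (K := K) L 𝔩 hpl τ q hζ hα0 e₀ e₁ n hα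
  have hk_ann : Ann 𝔩 q (fun b : (ZMod p)ˣ =>
      (((l - 2) * val (primeOver (K := K) L 𝔩 b) α : ℕ) : ZMod q)) := by
    have := (ann_val (K := K) L 𝔩 hpl hl1 hlq hτ hεu hα0 hα).nsmul
      (Ring.ne_bot_of_isMaximal_of_not_isField h𝔩m (RingOfIntegers.not_isField K)) (l - 2)
    convert this using 1
    funext b
    simp only [Pi.smul_apply, nsmul_eq_mul, Nat.cast_mul]
  -- G3: the index vector of `u₀^θ`
  have hu : Rep 𝔩 s q (galPow t u₀) (fun b : (ZMod p)ˣ => (l - 2) * val (primeOver (K := K) L 𝔩 b) α) := by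
    have h1 : Rep 𝔩 s q (galPow t u₀ * w ^ q)
        ((fun b : (ZMod p)ˣ => (l - 2) * val (primeOver (K := K) L 𝔩 b) α) + 0) := by
      rw [H]
      exact hk_rep.mul (Rep.pow_q hv)
    rw [add_zero] at h1
    exact Rep.of_mul_pow h𝔩max h1 hw
  exact Ann.of_galPow hp2 hq h𝔩max hs hsq ht hu hk_ann hy he

include hK hL h𝔩m h𝔩l in
/-- **[Schoof2009, Theorem 16.3] for a given auxiliary prime, final form** (the primitive-root
hypotheses of `ann_of_galPow_mul_pow_eq` discharged: `s ∈ [1, l-1]` and `𝓞 K/σ_b(𝔩) ≅ ℤ/l`).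
See `ann_of_galPow_mul_pow_eq` for the meaning of the hypotheses.
[cite: Schoof2009, Theorem 16.3 (proof, pp. 109–110)] [cite: Washington1997, Thm. 15.2] -/
theorem thaine_aux (hp2 : p ≠ 2) {q : ℕ} [NeZero q] (hq : Odd q) (hpl : p ≠ l)
    (hl1 : p ∣ l - 1) (hlq : q ∣ l - 1) {τ : Gal(L/K)} (hτ : ∀ x, x ∈ Subgroup.zpowers τ)
    {ζ : K} (hζ : IsPrimitiveRoot ζ p) {t : (ZMod p)ˣ → ℕ} (ht : ∀ b, t (-b) = t b)
    {u₀ v w : 𝓞 K} (hv : ∀ b, v ∉ gal p K b • 𝔩) (hw : ∀ b, w ∉ gal p K b • 𝔩)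
    {e₀ e₁ : ℕ} {n : (ZMod p)ˣ → ℕ} (H : galPow t u₀ * w ^ q = cycElt hζ e₀ e₁ n * v ^ q)
    {y e : (ZMod p)ˣ → ℕ} (hy : Rep 𝔩 ((galEquiv L hpl τ : (ZMod l)ˣ) : ZMod l).val q (galPow y u₀) e)
    (he : ∀ c, (e c : ZMod q) = if c = 1 ∨ c = -1 then (((q + 1) / 2 : ℕ) : ZMod q) else 0) :
    Ann 𝔩 q (fun b : (ZMod p)ˣ => (t b : ZMod q)) := by
  haveI : NeZero l := ⟨hl.out.ne_zero⟩
  refine ann_of_galPow_mul_pow_eq (K := K) L 𝔩 hp2 hq hpl hl1 hlq hτ (fun b => ?_) (fun b d h => ?_)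
    hζ ht hv hw H hy he
  · refine natCast_not_mem_smul (K := K) (l := l) 𝔩 (fun h => ?_) b
    have h1 := Nat.le_of_dvd (ZMod.val_pos.mpr (Units.ne_zero _)) h
    have h2 := ZMod.val_lt ((galEquiv L hpl τ : (ZMod l)ˣ) : ZMod l)
    omega
  · exact dvd_of_pow_sub_pow_mem (K := K) L 𝔩 hpl hl1 hlq hτ b d h

end Glue

end Catalan.Thaine

end Literature.NumberTheory.DiophantineGeometry
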